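import Mathlib
import HarnessLib
import HarnessLib.Audit
import Summits.CriticalPhenomena.Statement
import Literature.MathematicalPhysics.QuantumFieldTheory.PointwiseOSReconstruction
import Literature.Probability.LatticeModels.ScalingLimit3DProofs
import Summits.CriticalPhenomena.Ising3DConformalLimit.Theorems.CanonicalBranchRefutationCanonicalDimensionIsWickHarmonicPairSandwichIsWick

/-!
Route: CanonicalBranchRefutation

CLOSED (closed) 2026-08-17T09:17:08Z by planner-rchoice-CriticalPhenomena-CanonicalBra-c287602a-0 — reason: served (route-choice, judged-X rj4 2026-08-17): every substantive item proved — lever CanonicalDimensionIsWick (stmt-15520, p147937), IsingLimitHeritage (15523, p147470), CanonicalHarmonicity (15524, p148232), HarmonicPairSandwichIsWick (15 — note: route-choice by planner-rchoice-CriticalPhenomena-CanonicalBra-c287602a-0 (memo DECISION-CanonicalBranchRefutation.md attached as evidence on the route and on stmt-15521). X verdict ACCEPTED: closes : CanonicalDimensionIsWick → InfraredExponentZero → IsingLimitHeritage → ¬Ising3DConformalLimit is ce. The file is kept as the record of this route; refuted decls are indexed as negative knowledge (`ledger negatives`).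

# Route CanonicalBranchRefutation — negation lens — on the canonical branch η(3)=0 the conjunct is
false, since Möbius covariance at Δ=½ forces Wick by potential theory

REFUTATION-SHAPED ROUTE (negation lens, human-ordered ideation push 2026-08-16; `closes` concludes
¬Ising3DConformalLimit). To refute
the conjunct it suffices to show X = (Z) ∧ (W). (Z) InfraredExponentZero — THE BRANCH HYPOTHESIS:
the critical two-point function of
the n.n. Ising model on ℤ³ has anomalous dimension η = 0 in the logarithmic sense,
log⟨σ₀σ_x⟩_{β_c}/log‖x‖ → −1 (the 'canonical' or
Coulomb-with-logs branch; believed FALSE, η ≈ 0.036; rigorously open both ways). (W)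
CanonicalDimensionIsWick — THE LEVER, a theorem
we expect to be PROVABLE NOW: every correlation family on ℝ³ that is a pointwise scaling limit of
some lattice family, is OS-reflection
positive along the three axes, obeys the GKS-II / Lebowitz sandwich S₂S₂ ≤ S₄ ≤ ΣS₂S₂ on
non-coincident quadruples, has S₂ > 0 and is
Möbius covariant with Δ = 1/2 = (d−2)/2, has U₄ ≡ 0 off the diagonals. Given a witness (ρ,Δ,S) of
the conjunct, (Z) pins Δ = (1+η)/2 = 1/2
(inside `closes`, by the LANDED Literature scaling relation crit-ising.S22 `2Δ = d − 2 + η`,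
`IsingScalingRelationHolds.of_neZero` in
Literature.Probability.LatticeModels.ScalingLimit3DProofs — a light module whose import cone adds
nothing to the Statement's own; no Theorems
file is imported), the lattice bequeaths OS/GKS/Lebowitz to S (crux IsingLimitHeritage), and (W)
kills
clause (iii). DELIVERABLE even though (Z) is expected to die: once (W) and the supports land,
`closes` is the kernel-checked NECESSARY
CONDITION Ising3DConformalLimit ⇒ η_log(3) ≠ 0 (hence > 0): every proof of the summit must prove
η(3) > 0 on the way.
Lean: `InfraredExponentZero ∧ CanonicalDimensionIsWick`

## Assembly
Pure logic (glue.lean, rc 0; certified native at rev 7): from a witness (ρ,Δ,S) of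
Ising3DConformalLimit with U₄(x) ≠ 0 at some non-coincident x,
InfraredExponentZero and the landed scaling relation `IsingScalingRelationHolds.of_neZero` (fed
scale covariance read off Möbius covariance and
non-degeneracy) give 2Δ = 1, i.e. Δ = 1/2; IsingLimitHeritage supplies OS positivity along the axes,
the three GKS pairings and Lebowitz for S;
CanonicalDimensionIsWick (with G := criticalCorr 3) gives U₄(x) = 0 — contradiction. The deciding
theorem
`closes : CanonicalDimensionIsWick → InfraredExponentZero → IsingLimitHeritage →
¬Ising3DConformalLimit` (hypotheses = the three CRUX items only)
is what counts; the Assembly item below records the same implication as a statement. Imports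
(repairs of 2026-08-16): the Statement,
PointwiseOSReconstruction and ScalingLimit3DProofs only — no Theorems file — so the module cone
carries no unproved named fact beyond those the
sub-problem Statement itself imports, and the former support ZeroEtaPinsDelta (Δ-pin as an item) is
superseded by the inline S22 call.

Rationale: WHY THIS LINE. Hunting the counterexample branch by branch (no limit ∨ no inversion ∨ Gaussian), the
only branch with a typed, provable obstruction that
no open route owns is the Gaussian one read BACKWARDS: at the unitarity bound Δ = (d−2)/2 the
conformal weight of the inversion IS the
Kelvin weight, so inversion covariance of S₄ is Kelvin invariance; OS positivity (inherited from
bond-plane reflection positivity,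
FrohlichIsraelLiebSimon1978, GlimmJaffe1987 §6.1) applied to the smeared vector ∫Δf(y)[y]dy, whose
norm vanishes because the reflected
kernel C/‖θy−y′‖ is harmonic, makes y ↦ S₄(y,X) weakly harmonic on every far half-space
(Folland1995PDE Cor. 2.20), the step-function
structure of a lattice limit upgrades a.e. to everywhere, Kelvin (Folland1995PDE Thm. 2.73) carries
harmonicity inside the box of X, and then
F = S₄(·,X) − Wick is harmonic off three poles, bounded near them by the GKS-II/Lebowitz sandwich
(FriedliVelenik2017 Thm. 3.20,
Lebowitz1974), hence removable (Folland1995PDE Thm. 2.69), ≤ 0, → 0 at ∞, so ≡ 0 by Liouville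
(Folland1995PDE Thm. 2.16): U₄ ≡ 0.
This is a reconstruction-free, d = 3, n-point substitute for the Jost–Schroer–Pohlmeyer theorem
(StreaterWightman2001 Thm. 4-15,
Pohlmeyer1969) and for the CFT lore 'a scalar saturating Δ ≥ D/2−1 is free' (Rychkov2016 Lect. 3 §2,
level-2 null state), which the
standing disprovers of CoulombImpliesNontrivial (§6) and IsingEuclidUpgradeR4NonGaussian (§E.2)
record only as an OPEN prose reduction
'modulo OS reconstruction and a 3D Pohlmeyer'. Imported area: classical potential theory (Kelvin
transform, removable singularities,
Liouville) married to ferromagnetic correlation inequalities; nothing probabilistic beyond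
inheritance. What it does that prior routes do
not: it is the first route of the sub concluding ¬S; it is the CONVERSE edge of
AnomalousForcesInteraction's (GF) 'Gaussian ⇒ Δ = 1/2'
(together: for Möbius OS limits of ℤ³ Ising, Gaussian ⇔ canonical ⇔ η = 0), it formally closes
PerfectScreening's Coulomb branch for the
summit, and it upgrades AnomalousForcesInteraction's crux EtaPositive from sufficient-with-(GF) to
NECESSARY. Negatives index: no Ising3D
entry; the ∀-over-S typing trap that refuted IsingEuclidUpgrade's (U) (junk on the coincident locus)
is avoided — every hypothesis and the
conclusion of (W) live on NonCoincident, and (W) is non-vacuous (the lattice GFF limit satisfies all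
its hypotheses).

RANKED CRUXES. #2 CanonicalDimensionIsWick (crux) — potential-theoretic Wick rigidity at the
canonical dimension: a pointwise lattice scaling limit S on ℝ³ that is OS-positive along the three
axes, GKS/Lebowitz-sandwiched on non-coincident quadruples, non-degenerate and Möbius covariant with
Δ = 1/2 has vanishing connected four-point function off the diagonals. [difficulty: L] (why it might
fail: S may be DISCONTINUOUS (continuity of pointwise limits is not automatic); the
smeared-Laplacian OS argument and the a.e.→everywhere upgrade must run on point configurations only,
and Kelvin must reach inside conv(X); a gap there leaves Wick − ε(x₁₂x₃₄)⁻¹u^{1/2}ψ(v) alive.)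
[Pohlmeyer1969, StreaterWightman2001, Rychkov2016, Folland1995PDE, GlimmJaffe1987,
FrohlichIsraelLiebSimon1978, Lebowitz1974, FriedliVelenik2017]
#3 InfraredExponentZero (crux) — THE BRANCH HYPOTHESIS (bet of the negation lens, expected FALSE):
η(3) = 0 in the logarithmic sense, log⟨σ₀σ_x⟩⁺_{β_c(3)}/log‖x‖ → −1 along x → ∞ in ℤ³ (covers the
two-sided Coulomb law c/‖x‖ ≤ G ≤ C/‖x‖ and its log-corrected variants). Provers: do NOT attempt;
refuters: its refutation is exactly 'η(3) > 0 or η does not exist', i.e. it dies with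
AnomalousForcesInteraction.EtaPositive or PerfectScreening.NonSaturation+ScreeningUpgrade.
[difficulty: open-problem] (why it might fail: it is believed FALSE: η = 0.036298(2) (bootstrap,
KPSV16), 0.03627(10) (MC); rigorously only 0 ≤ η ≤ 1/2 if η exists (IR bound; DCP25 Thm 1.5) — no
proof of either sign of η ≠ 0 is in print.) [KosPolandSimmonsDuffinVichi2016, Hasenbusch2010,
FrohlichSimonSpencer1976, DuminilCopinPanis2025LowerBounds, DuminilCopinICM2022]
#4 IsingLimitHeritage (crux) — every pointwise scaling limit S of criticalCorr 3 (any ρ > 0)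
inherits (a) OS reflection positivity along each axis in the pointwise sense (bond-plane RP of the
n.n. model: the floor map sends the reflected point to the BOND mirror image, so no continuity of S
is needed), (b) GKS II for all three pairings, (c) Lebowitz U₄ ≤ 0 ((b) for one pairing and (c) are
in tree: limit_four_ge_two_mul_two, limitConnectedFour_nonpos_of_hasPointwiseScalingLimit).
[difficulty: M] (why it might fail: for a possibly DISCONTINUOUS limit there is no continuity
absorption (unlike ClusterPointOS): the floor map sends reflected points to BOND-mirror images, so
bond-plane RP of the infinite-volume β_c state (torus RP → box limit) is needed, on generic meshes
of the filter.) [FrohlichIsraelLiebSimon1978, GlimmJaffe1987, FriedliVelenik2017, Lebowitz1974]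
#9 CanonicalHarmonicity (support) — first half of the lever: under the hypotheses of
CanonicalDimensionIsWick, for every injective triple X the function y ↦ S₄(y,X) is harmonic on ℝ³ ∖
X (OS null vector ⇒ weakly harmonic on far half-spaces; Weyl; step-function a.e.→everywhere upgrade;
Kelvin = inversion covariance at Δ = 1/2 carries it inside the bounding box of X). [difficulty: L]
[GlimmJaffe1987, Folland1995PDE, Pohlmeyer1969]
#9 HarmonicPairSandwichIsWick (support) — second half of the lever, pure potential theory on ℝ³: a
function harmonic off three distinct poles p_j, sandwiched between each w_j/‖y−p_j‖ from below and
Σ_j w_j/‖y−p_j‖ from above (w_j ≥ 0), equals Σ_j w_j/‖y−p_j‖ (difference is ≤ 0, bounded near each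
pole hence removable, → 0 at ∞, so ≡ 0 by Liouville). [difficulty: M] [Folland1995PDE]

TWO-LAYER PLAN. CanonicalDimensionIsWick ⇐ CanonicalHarmonicity → HarmonicPairSandwichIsWick →
CanonicalDimensionIsWick (the two supports are the foreseen
children; the glue is: S₂(y,x_j) = A‖y−x_j‖⁻¹ by two_point_radial, weights w_j = A·S₂(pair_j), F =
S₄(·,X)). IsingLimitHeritage ⇐ OS-along-axes
(bond-plane RP + floor bookkeeping) → GKS-three-pairings → Lebowitz-in-limit (the last two in tree).

KILL CRITERIA. (a) InfraredExponentZero refuted (η_log(3) ≠ 0 proved — e.g.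
AnomalousForcesInteraction.EtaPositive, or PerfectScreening's NonSaturation +
ScreeningUpgrade, or any HasIsingEtaBounds 3 η with η > 0) closes the route
`refuted:InfraredExponentZero` — EXPECTED; if CanonicalDimensionIsWick
and the supports have landed by then, the necessary condition S ⇒ η_log(3) ≠ 0 is banked as the
contrapositive of `closes` and the route has
served. (b) A counterexample to CanonicalDimensionIsWick (an OS-positive, sandwich-compatible,
Möbius(½) lattice-limit family with U₄ ≢ 0)
kills the lever and the route outright (close refuted:CanonicalDimensionIsWick). (c)
Ising3DConformalLimit proved elsewhere ⇒ `closes`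
yields ¬InfraredExponentZero as a theorem and the route closes refuted with its deliverable
realised.

NOT DECOMPOSED YET. The OS-inheritance bookkeeping (bond vs site mirror, countably many exceptional
meshes), Weyl's lemma and the removable-singularity /
Kelvin lemmas in Lean (Mathlib has InnerProductSpace.HarmonicAt/HarmonicOnNhd but no
Bôcher/Weyl/Kelvin yet), and the general-n
version (Newman's Gaussian inequality pins all residues, giving full Wick structure) are layer-2 or
prover-side; only n = 4 is needed.

CHEAPEST FALSIFIER. For the lever: take the explicit Möbius(½), sandwich-compatible, non-harmonic
family S₄ = Wick − ε(x₁₂x₃₄)⁻¹u^{1/2}ψ(v) and run the proof's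
own 2×2 Gram test (smeared Laplacian vector u = ∫Δf(y)[y]dy against v = [X]): B(u,u) = 0 while
B(u,v) = ∫Δf·U₄(θ·,X) ≠ 0, so OS FAILS —
consistent (a refuter can check this symbolically/numerically in minutes; if instead such a family
passed an honest OS test the lever is
dead). For the bet: none cheap — η ≈ 0.0363 numerically; rigorously open. I ran: lean check of
Sketch.lean (rc 0; re-run 2026-08-16 with ONLY the Statement + PointwiseOSReconstruction imports, rc
0), of Scratch.lean /
ScratchPin.lean (Δ = 1/2 from η = 0 proved in 3 lines from delta_eq_of_eta, rc 0; Lebowitz-in-limit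
in tree) and of Sketch2.lean (rev 7: Δ = 1/2 from η = 0
via the Literature fact IsingScalingRelationHolds.of_neZero with imports Statement +
PointwiseOSReconstruction + ScalingLimit3DProofs, `example : Assembly := closes`, rc 0;
the gate's native audit of `closes`: ok, hypotheses = the three cruxes, non_crux [], extra []).

NUMBERS. Δ_σ = 0.5181489(10), η = 2Δ_σ − 1 = 0.036298(2) (KosPolandSimmonsDuffinVichi2016); η =
0.03627(10) (Hasenbusch2010); rigorous window for any
covariant limit: Δ ∈ [1/2, 3/4] (IR bound FrohlichSimonSpencer1976; DuminilCopinPanis2025LowerBounds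
Thm 1.5; in tree
delta_mem_Icc_of_covariantLimit). Items at open: 5 (3 cruxes, 2 supports) + Assembly; after the
repairs of 2026-08-16 (rev 7): again 5 (3 cruxes, 2 supports) + Assembly, imports =
[PointwiseOSReconstruction, ScalingLimit3DProofs].

DEFINITION REQUESTS. None: IsReflectionPositiveAlong
(Literature.MathematicalPhysics.QuantumFieldTheory.PointwiseOSReconstruction), HarmonicOnNhd
(Mathlib),
HasIsingExponentEta, limitConnectedFour, NonCoincident exist.

Novelty: Searches (2026-08-16): tree — `lean search` for Bôcher/Kelvin/Pohlmeyer/harmonic (prose hits only: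
Cruxes/CoulombImpliesNontrivial/Disproof §6, Cruxes/IsingEuclidUpgradeR4NonGaussian/Disproof §E.2,
Theses/PerfectScreening rationale 'OS harmonic bootstrap', Theses/AnomalousForcesInteraction
'converse not needed'); all 45 Theses headers and the closed/open negation cards
(gff-vertex-of-the-rigorous-polytope, eta-half-watershed, three-quarters-loophole-reductio,
rp-descendant-witness-barrier, rp-cannot-fix-the-scale-log-periodic, commensurate-rotation-no-go,
virial-audit) read; `ledger negatives --problem CriticalPhenomena` (10 items, none Ising3D); `lit
search --hybrid` ×5 (Jost–Schroer: StreaterWightman2001 Thm 4-15 read p.146; unitarity bound: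
Rychkov2016 Lect.3 §2 read; potential theory: Folland1995PDE Thms 2.16/2.20/2.69/2.73 read; GNR 2024
dipolar scale-without-conformal surfaced); `lit galaxy search --star all` ×3 ('Jost-Schroer
theorem', 'saturates the unitarity bound', unitarity/η query: 0 relevant).
Nearest prior art found: Pohlmeyer1969 (massless Jost–Schroer, 4D Wightman framework) and the CFT
unitarity-bound lore Rychkov2016 Lect.3 §2 (Δ = D/2−1 ⇔ level-2 null state); in tree, the prose
'open reduction' of the two disprovers and AnomalousForcesInteraction's (GF) in the opposite
direction.
Delta: a reconstruction-free, three-dimensional, n-point-level proof that Möbius covariance at Δ =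
(d−2)/2 plus lattice-inherited OS/GKS/Lebowitz forces Wick (Kelvin = inversion at  [refs: StreaterWightman2001, Rychkov2016, Pohlmeyer1969]

Barriers (technique_class: conditional-refutation, potential-theory, os-positivity): - technique_class: conditional-refutation, potential-theory, os-positivity
- Literature.Barriers.CriticalPhenomena.IsingTrivialityFromDimensionFour: consistent, not evaded —
the lever is dimension-uniform in FORM (Δ = (d−2)/2 ⇒ Wick) and reproduces exactly the d ≥ 4
Gaussianity at canonical dimension; the d = 3 content sits entirely in the bet (Z), which the
barrier does not touch.
- Literature.Barriers.CriticalPhenomena.ScaleCovarianceNotMoebius: not applicable — inversion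
covariance is an INPUT here (used as Kelvin invariance), never derived from Euclid + scale.
- Literature.Barriers.CriticalPhenomena.SAWNoUnitaryCFT: not applicable — it concerns the SAW
conjunct and quantifies over positive-definite highest-weight c = 0 Virasoro modules (a local stress
tensor); here 'OS positivity' is planar lattice reflection positivity of the 3D Ising state
inherited pointwise by limits, with global Möbius symmetry only — exactly the setting its scope
caveat excludes (SAWNoUnitaryCFTNarrow).
- Literature.Barriers.CriticalPhenomena.BootstrapLatticeBlindness: evaded — no CFT axioms (OPE,
stress tensor, crossing) are assumed; only the conjunct's own clauses plus lattice-inherited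
OS/GKS/Lebowitz; the lever is a bootstrap-free unitarity bound.
- Negatives index: no Ising3D refuted statement at filing; the ∀-over-S coincident-locus junk that
refuted IsingEuclidUpgrade (U) (Theorems/IsingEuclidUpgradeRefutations.lean) is steered around — all
hypotheses/conclusions of (W) are on NonCoincident a

History (route lifecycle, newest last):
- 2026-08-16T15:13:56Z · rev 3: dropped ZeroEtaPinsDelta — redundant support: its 3-line proof from the landed delta_eq_of_eta is inlined in closes (rev 1) (planner-plan-lens-CriticalPhenomena-negation-0)
- 2026-08-16T15:22:32Z · rev 4: restated Assembly (stmt-CriticalPhenomena-15526) — route-repair: restate the blocked Assembly item without ZeroEtaPinsDelta (dropped rev 3); it is now literally the type of closes (checked rc 0 in SketchStandalo (planner-rbadge-CriticalPhenomena-CanonicalBran-1a1ab601-0)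
- 2026-08-16T15:28:52Z · rev 7: dropped ZeroEtaPinsDelta — route-repair (joint fix for BOTH repair seats — cone AND glue stamp): Δ = 1/2 is now derived INSIDE closes from InfraredExponentZero via the landed Literature f (planner-rbadge-CriticalPhenomena-CanonicalBran-1a1ab601-0)
- 2026-08-17T09:17:08Z · CLOSED closed — served (route-choice, judged-X rj4 2026-08-17): every substantive item proved — lever CanonicalDimensionIsWick (stmt-15520, p147937), IsingLimitHeritage (15523, p147470), CanonicalHarmonicity (15524, (planner-rchoice-CriticalPhenomena-CanonicalBra-c287602a-0)

sub-problem: Ising3DConformalLimit · status: closed(closed) · opened planner-plan-lens-CriticalPhenomena-negation-0 2026-08-16T15:11:43Z · rev 8 · ledger route-CriticalPhenomena-CanonicalBranchRefutation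
GENERATED by the gate from the ledger (D-0016/17). Provers cite these decls: `theorem foo : Summit.CriticalPhenomena.Ising3DConformalLimit.Theses.CanonicalBranchRefutation.<Decl> := …` in Summits/CriticalPhenomena/Ising3DConformalLimit/Theorems/<Name>.lean.
-/

namespace Summit.CriticalPhenomena.Ising3DConformalLimit.Theses.CanonicalBranchRefutation

open scoped BigOperators Topology Manifold Classical MeasureTheory ProbabilityTheory Matrix InnerProductSpace ComplexConjugate ContinuousMap
open Filter Set Function TopologicalSpace MeasureTheory

attribute [summit_statement] _root_.Ising3DConformalLimit

/-- item stmt-CriticalPhenomena-15520 · crux · rank 2 · closed · proved by Summit.CriticalPhenomena.Ising3DConformalLimit.Cruxes.CanonicalDimensionIsWick.Birth.CanonicalDimensionIsWick_of_stubs @ b5e5323af2f2 (prover) · by planner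
why it might fail: S may be DISCONTINUOUS (continuity of pointwise limits is not automatic); the smeared-Laplacian OS argument and the a.e.→everywhere upgrade must run on point configurations only, and Kelvin must reach inside conv(X); a gap there leaves Wick − ε(x₁₂x₃₄)⁻¹u^{1/2}ψ(v) alive.
sources: Pohlmeyer1969, StreaterWightman2001, Rychkov2016, Folland1995PDE, GlimmJaffe1987, FrohlichIsraelLiebSimon1978
[crux] potential-theoretic Wick rigidity at the canonical dimension: a pointwise lattice scaling
limit S on ℝ³ that is OS-positive along the three axes, GKS/Lebowitz-sandwiched on non-coincident
quadruples, non-degenerate and Möbius covariant with Δ = 1/2 has vanishing connected four-point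
function off the diagonals. [difficulty: L] -/
@[route_item "route-CriticalPhenomena-CanonicalBranchRefutation"]
def CanonicalDimensionIsWick : Prop :=
  ∀ S : Literature.Probability.LatticeModels.CorrFamily 3, (∃ (G : Literature.Probability.LatticeModels.LatticeCorrFamily 3) (ρ : ℝ → ℝ), Literature.Probability.LatticeModels.HasPointwiseScalingLimit G ρ S) → (∀ τ : Fin 3, Literature.MathematicalPhysics.QuantumFieldTheory.IsReflectionPositiveAlong τ S) → (∀ x ∈ Literature.Probability.LatticeModels.NonCoincident 3 4, S 2 ![x 0, x 1] * S 2 ![x 2, x 3] ≤ S 4 x ∧ S 2 ![x 0, x 2] * S 2 ![x 1, x 3] ≤ S 4 x ∧ S 2 ![x 0, x 3] * S 2 ![x 1, x 2] ≤ S 4 x) → (∀ x ∈ Literature.Probability.LatticeModels.NonCoincident 3 4, Literature.Probability.LatticeModels.limitConnectedFour S x ≤ 0) → Literature.Probability.LatticeModels.IsNondegenerateTwoPoint S → Literature.Probability.LatticeModels.IsMoebiusCovariant (1 / 2 : ℝ) S → ∀ x ∈ Literature.Probability.LatticeModels.NonCoincident 3 4, Literature.Probability.LatticeModels.limitConnectedFour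 S x = 0

/-- item stmt-CriticalPhenomena-15521 · crux · rank 3 · closed · moot by None · by planner
why it might fail: it is believed FALSE: η = 0.036298(2) (bootstrap, KPSV16), 0.03627(10) (MC); rigorously only 0 ≤ η ≤ 1/2 if η exists (IR bound; DCP25 Thm 1.5) — no proof of either sign of η ≠ 0 is in print.
sources: KosPolandSimmonsDuffinVichi2016, Hasenbusch2010, FrohlichSimonSpencer1976, DuminilCopinPanis2025LowerBounds, DuminilCopinICM2022
[crux] THE BRANCH HYPOTHESIS (bet of the negation lens, expected FALSE): η(3) = 0 in the logarithmic
sense, log⟨σ₀σ_x⟩⁺_{β_c(3)}/log‖x‖ → −1 along x → ∞ in ℤ³ (covers the two-sided Coulomb law c/‖x‖ ≤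
G ≤ C/‖x‖ and its log-corrected variants). Provers: do NOT attempt; refuters: its refutation is
exactly 'η(3) > 0 or η does not exist', i.e. it dies with AnomalousForcesInteraction.EtaPositive or
PerfectScreening.NonSaturation+ScreeningUpgrade. [difficulty: open-problem] -/
@[route_item "route-CriticalPhenomena-CanonicalBranchRefutation"]
def InfraredExponentZero : Prop :=
  Literature.Probability.LatticeModels.HasIsingExponentEta 3 0

/-- item stmt-CriticalPhenomena-15523 · crux · rank 9 · closed · proved by Summit.CriticalPhenomena.Ising3DConformalLimit.Cruxes.IsingLimitHeritage.Birth.IsingLimitHeritage_of_stubs @ 008e57d4c780 (prover) · by planner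
why it might fail: for a possibly DISCONTINUOUS limit there is no continuity absorption (unlike ClusterPointOS): the floor map sends reflected points to BOND-mirror images, so bond-plane RP of the infinite-volume β_c state (torus RP → box limit) is needed, on generic meshes of the filter.
sources: FrohlichIsraelLiebSimon1978, GlimmJaffe1987, FriedliVelenik2017, Lebowitz1974
[support] every pointwise scaling limit S of criticalCorr 3 (any ρ > 0) inherits (a) OS reflection
positivity along each axis in the pointwise sense (bond-plane RP of the n.n. model: the floor map
sends the reflected point to the BOND mirror image, so no continuity of S is needed), (b) GKS II for
all three pairings, (c) Lebowitz U₄ ≤ 0 ((b) for one pairing and (c) are in tree: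
limit_four_ge_two_mul_two, limitConnectedFour_nonpos_of_hasPointwiseScalingLimit). [difficulty: M] -/
@[route_item "route-CriticalPhenomena-CanonicalBranchRefutation"]
def IsingLimitHeritage : Prop :=
  ∀ (ρ : ℝ → ℝ) (S : Literature.Probability.LatticeModels.CorrFamily 3), (∀ δ ∈ Set.Ioc (0:ℝ) 1, 0 < ρ δ) → Literature.Probability.LatticeModels.HasPointwiseScalingLimit (Literature.Probability.LatticeModels.criticalCorr 3) ρ S → (∀ τ : Fin 3, Literature.MathematicalPhysics.QuantumFieldTheory.IsReflectionPositiveAlong τ S) ∧ (∀ x ∈ Literature.Probability.LatticeModels.NonCoincident 3 4, S 2 ![x 0, x 1] * S 2 ![x 2, x 3] ≤ S 4 x ∧ S 2 ![x 0, x 2] * S 2 ![x 1, x 3] ≤ S 4 x ∧ S 2 ![x 0, x 3] * S 2 ![x 1, x 2] ≤ S 4 x) ∧ (∀ x ∈ Literature.Probability.LatticeModels.NonCoincident 3 4, Literature.Probability.LatticeModels.limitConnectedFour S x ≤ 0)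

/-- item stmt-CriticalPhenomena-15524 · support · rank 9 · closed · proved by Summit.CriticalPhenomena.Ising3DConformalLimit.Cruxes.CanonicalDimensionIsWick.Birth.CanonicalHarmonicity_proof @ 803191295cea (prover) · by planner
sources: GlimmJaffe1987, Folland1995PDE, Pohlmeyer1969
[support] first half of the lever: under the hypotheses of CanonicalDimensionIsWick, for every
injective triple X the function y ↦ S₄(y,X) is harmonic on ℝ³ ∖ X (OS null vector ⇒ weakly harmonic
on far half-spaces; Weyl; step-function a.e.→everywhere upgrade; Kelvin = inversion covariance at Δ
= 1/2 carries it inside the bounding box of X). [difficulty: L] -/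
@[route_item "route-CriticalPhenomena-CanonicalBranchRefutation"]
def CanonicalHarmonicity : Prop :=
  ∀ S : Literature.Probability.LatticeModels.CorrFamily 3, (∃ (G : Literature.Probability.LatticeModels.LatticeCorrFamily 3) (ρ : ℝ → ℝ), Literature.Probability.LatticeModels.HasPointwiseScalingLimit G ρ S) → (∀ τ : Fin 3, Literature.MathematicalPhysics.QuantumFieldTheory.IsReflectionPositiveAlong τ S) → (∀ x ∈ Literature.Probability.LatticeModels.NonCoincident 3 4, S 2 ![x 0, x 1] * S 2 ![x 2, x 3] ≤ S 4 x ∧ S 2 ![x 0, x 2] * S 2 ![x 1, x 3] ≤ S 4 x ∧ S 2 ![x 0, x 3] * S 2 ![x 1, x 2] ≤ S 4 x) → (∀ x ∈ Literature.Probability.LatticeModels.NonCoincident 3 4, Literature.Probability.LatticeModels.limitConnectedFour S x ≤ 0) → Literature.Probability.LatticeModels.IsNondegenerateTwoPoint S → Literature.Probability.LatticeModels.IsMoebiusCovariant (1 / 2 : ℝ) S → ∀ X : Fin 3 → EuclideanSpace ℝ (Fin 3), Function.Injective X → InnerProductSpace.HarmonicOnNhd (fun y => S 4 (Fin.cons y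 X)) (Set.range X)ᶜ

/-- item stmt-CriticalPhenomena-15525 · support · rank 9 · closed · proved by Summit.CriticalPhenomena.Ising3DConformalLimit.Cruxes.CanonicalDimensionIsWick.Birth.stub_harmonicPairSandwichIsWick @ a825d9c8901b (prover) · by planner
sources: Folland1995PDE
[support] second half of the lever, pure potential theory on ℝ³: a function harmonic off three
distinct poles p_j, sandwiched between each w_j/‖y−p_j‖ from below and Σ_j w_j/‖y−p_j‖ from above
(w_j ≥ 0), equals Σ_j w_j/‖y−p_j‖ (difference is ≤ 0, bounded near each pole hence removable, → 0 at
∞, so ≡ 0 by Liouville). [difficulty: M] -/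
@[route_item "route-CriticalPhenomena-CanonicalBranchRefutation"]
def HarmonicPairSandwichIsWick : Prop :=
  ∀ (p : Fin 3 → EuclideanSpace ℝ (Fin 3)) (w : Fin 3 → ℝ) (F : EuclideanSpace ℝ (Fin 3) → ℝ), Function.Injective p → (∀ j, 0 ≤ w j) → InnerProductSpace.HarmonicOnNhd F (Set.range p)ᶜ → (∀ y ∉ Set.range p, ∀ j, w j * ‖y - p j‖⁻¹ ≤ F y) → (∀ y ∉ Set.range p, F y ≤ ∑ j, w j * ‖y - p j‖⁻¹) → ∀ y ∉ Set.range p, F y = ∑ j, w j * ‖y - p j‖⁻¹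

/-- `HarmonicPairSandwichIsWick` holds: proved by `Summit.CriticalPhenomena.Ising3DConformalLimit.Cruxes.CanonicalDimensionIsWick.Birth.stub_harmonicPairSandwichIsWick` @ a825d9c8901b. -/
theorem HarmonicPairSandwichIsWick_holds : HarmonicPairSandwichIsWick := _root_.Summit.CriticalPhenomena.Ising3DConformalLimit.Cruxes.CanonicalDimensionIsWick.Birth.stub_harmonicPairSandwichIsWick

-- earlier Assembly (stmt-CriticalPhenomena-15526, replaced 2026-08-16T15:22:32Z -> stmt-CriticalPhenomena-15318): retired by None — CanonicalDimensionIsWick → InfraredExponentZero → ZeroEtaPinsDelta → IsingLimitHeritage → ¬ Ising3DConformalLimit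
/-- item stmt-CriticalPhenomena-15318 · assembly · rank 1 · closed · moot by None · by planner
sources: Pohlmeyer1969, DuminilCopinICM2022
[assembly] CanonicalDimensionIsWick → InfraredExponentZero → IsingLimitHeritage → ¬
Ising3DConformalLimit (refutation shape; literally the type of the deciding theorem `closes`, rev ≥
4: ZeroEtaPinsDelta was dropped at rev 3, its 3-line content — Δ = (1+η)/2 = 1/2 from the landed
MoebiusLimitExistsNegative.delta_eq_of_eta — is inlined in `closes`). -/
@[route_item "route-CriticalPhenomena-CanonicalBranchRefutation"]
def Assembly : Prop :=
  CanonicalDimensionIsWick → InfraredExponentZero → IsingLimitHeritage → ¬ Ising3DConformalLimit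

end Summit.CriticalPhenomena.Ising3DConformalLimit.Theses.CanonicalBranchRefutation
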